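import Mathlib.Topology.Algebra.ClopenNhdofOne
import Mathlib.FieldTheory.Galois.Infinite
import Literature.NumberTheory.GaloisRepresentations.LocalReciprocityProofs
import Literature.NumberTheory.GaloisRepresentations.LocalGlobalCohomologyFiniteProofs
import Literature.AnabelianGeometry.AbsoluteAnabelian.LocalClassFieldTheoryForms
import HarnessLib

/-!
# Local reciprocity: the open subgroups `θ⁻¹(V)` are cofinal among finite-index subgroups of `Kˣ`

Auxiliaries for the DISCHARGE of the LCFT form `mlf_reciprocity_completion` of
`LocalClassFieldTheoryForms.lean` ([AbsAnab] §1.2 p. 9, "`(K^×)^∧ ≅ G_K^{ab}`"; the discharge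
itself is `LocalReciprocityCompletionProofs.lean`).  For a non-archimedean local field `K` of
characteristic `0` and a reciprocity map `θ : Kˣ → G_K^{ab}` (`IsLocalReciprocityMap`, PROVED to
exist in the tree's `GaloisRepresentations` trunk):

* `QuotientGroup.totallyDisconnectedSpace_of_isClosed` — the quotient of a profinite group by a
  closed normal subgroup is totally disconnected; hence `G_K^{ab}` is profinite and Hausdorff.
* `mem_of_valuation_sub_one_lt` — a unit `u` with `v(u - 1) < v(m²)`, `m = [Kˣ : N]`, lies in
  `N` (Hensel: `1 + m²𝔪 ⊆ (1 + m𝔪)^m`, tree `exists_units_pow_eq_one_add`; char. `0`).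
* `exists_isOpen_units_criterion` — an open `V₀ ≤ G_K^{ab}` with `u ∈ U_K, θ u ∈ V₀ ⇒ u ∈ N`
  (`θ|_{U_K}` is an embedding).
* `exists_isOpen_frobenius_criterion` — an open `V₁ ⊇ θ(U_K)` with `θ(ϖ)^k ∈ V₁ ⇒ m' ∣ k`
  (stabiliser of the unramified level of degree `m'`, tree `smul_eq_self_iff_dvd_of_isFrobPow`).
* `exists_isOpen_comap_le` — **for every finite-index `N ≤ Kˣ` there is an open `V ≤ G_K^{ab}`
  with `θ⁻¹(V) ≤ N`** (Serre, *Local Fields* XIV §6 Thm. 1 and Cor. 1, in the form the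
  completion argument needs).

Theorems only: no new definitions, no named facts.  HONEST FRAMING: classical local class field
theory; nothing here bears on [IUTchIII] Cor. 3.12. [cite: MochizukiAbsAnab2004, §1.2 p.9]
-/

noncomputable section

open CategoryTheory Topology Filter
open ValuativeRel Field
open scoped Pointwise

namespace Literature.AnabelianGeometry.AbsoluteAnabelian

open Literature.NumberTheory.GaloisRepresentations

universe u

/-! ### Quotients of profinite groups by closed normal subgroups are profinite -/

/-- The quotient of a compact totally disconnected topological group by a CLOSED normal
subgroup is totally disconnected (hence profinite): two distinct cosets `gN ≠ g'N` are separated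
by the clopen image of `g · (H ⊔ N)` for an open subgroup `H` with `H⁻¹ · g⁻¹g' ∩ N = ∅`.
(Ribes–Zalesskii, *Profinite Groups*, Prop. 2.2.1 (a); auxiliary for [AbsAnab] §1.2
"`G_K^{ab}`".) [cite: MochizukiAbsAnab2004, §1.2 p.9] -/
theorem QuotientGroup.totallyDisconnectedSpace_of_isClosed {G : Type*} [Group G]
    [TopologicalSpace G] [IsTopologicalGroup G] [CompactSpace G] [TotallyDisconnectedSpace G]
    (N : Subgroup G) [N.Normal] (hN : IsClosed (N : Set G)) :
    TotallyDisconnectedSpace (G ⧸ N) := by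
  haveI : TotallySeparatedSpace (G ⧸ N) := by
    rw [totallySeparatedSpace_iff_exists_isClopen]
    intro x y hxy
    obtain ⟨g, rfl⟩ := QuotientGroup.mk_surjective x
    obtain ⟨g', rfl⟩ := QuotientGroup.mk_surjective y
    set h : G := g⁻¹ * g' with hh
    have hhN : h ∉ N := fun hmem => hxy (QuotientGroup.eq.mpr hmem)
    let O : Set G := (fun k : G => k * h) ⁻¹' (N : Set G)ᶜ
    have hO : IsOpen O := hN.isOpen_compl.preimage (continuous_id.mul continuous_const)
    have h1O : (1 : G) ∈ O := by
      change 1 * h ∈ (N : Set G)ᶜ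
      rw [one_mul]; exact hhN
    obtain ⟨H, hH⟩ := ProfiniteGrp.exist_openNormalSubgroup_sub_open_nhds_of_one hO h1O
    let S : Subgroup G := H.toSubgroup ⊔ N
    have hSopen : IsOpen (S : Set G) := Subgroup.isOpen_mono le_sup_left H.isOpen'
    have hSclosed : IsClosed (S : Set G) := Subgroup.isClosed_of_isOpen _ hSopen
    refine ⟨QuotientGroup.mk '' (g • (S : Set G)), ⟨?_, ?_⟩, ?_, ?_⟩
    · exact QuotientGroup.isClosedMap_coe hN.isCompact _ (hSclosed.smul g)
    · exact QuotientGroup.isOpenMap_coe _ (hSopen.smul g)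
    · exact ⟨g, ⟨1, S.one_mem, by simp⟩, rfl⟩
    · rintro ⟨s, ⟨t, ht, rfl⟩, hs⟩
      -- `mk (g • t) = mk g'` with `t ∈ H ⊔ N`
      have hmem : (g • t)⁻¹ * g' ∈ N := QuotientGroup.eq.mp hs
      have ht' : h ∈ (S : Set G) := by
        have h2 : h = t * ((g • t)⁻¹ * g') := by
          rw [hh, smul_eq_mul, mul_inv_rev]; group
        rw [h2]
        exact S.mul_mem ht (Subgroup.mem_sup_right hmem)
      rw [Subgroup.mul_normal] at ht'
      obtain ⟨k, hk, n, hn, hkn⟩ := ht'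
      have hk' : k⁻¹ ∈ O := hH (H.toSubgroup.inv_mem hk)
      apply hk'
      change k⁻¹ * h ∈ (N : Set G)
      rw [← hkn, inv_mul_cancel_left]
      exact hn
  infer_instance

/-- `G_K^{ab}` is totally disconnected (profinite): quotient of the profinite `G_K` by the
closed subgroup `closure [G_K, G_K]`. [cite: MochizukiAbsAnab2004, §1.2 p.9] -/
theorem totallyDisconnectedSpace_absoluteGaloisGroupAbelianization (K : Type u) [Field K]
    [CharZero K] :
    TotallyDisconnectedSpace (absoluteGaloisGroupAbelianization K) :=
  QuotientGroup.totallyDisconnectedSpace_of_isClosed _ (Subgroup.isClosed_topologicalClosure _)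

/-! ### The local field: units and the criterion `u ≡ 1 (mod m²𝔪) ⇒ u ∈ N` -/

section Local

variable (K : Type u) [Field K] [ValuativeRel K] [TopologicalSpace K]
  [IsNonarchimedeanLocalField K] [CharZero K]

/-- For a subgroup `N ≤ Kˣ` of finite index `m` (characteristic `0`), a unit `u` of `K` with
`v(u - 1) < v(m²)` lies in `N`: `u = 1 + m² w` with `w ∈ 𝔪`, so `u = (1 + m y)^m` is an `m`-th
power by Hensel's lemma (tree `exists_units_pow_eq_one_add`), and `m`-th powers lie in `N`.
(Serre, *Local Fields* XIV §6 Cor. 1: finite-index subgroups of `K^×` are open, char. `0`;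
the step behind "(K^×)^∧" in [AbsAnab] §1.2.) [cite: MochizukiAbsAnab2004, §1.2 p.9] -/
theorem mem_of_valuation_sub_one_lt (N : Subgroup Kˣ) [N.FiniteIndex] (u : Kˣ)
    (hu : valuation K ((u : K) - 1) < valuation K (((N.index : ℕ) : K) ^ 2)) : u ∈ N := by
  set m : ℕ := N.index with hmdef
  have hm : m ≠ 0 := Subgroup.FiniteIndex.index_ne_zero
  have hmK : ((m : ℕ) : K) ≠ 0 := Nat.cast_ne_zero.mpr hm
  have hm2 : ((m : ℕ) : K) ^ 2 ≠ 0 := pow_ne_zero _ hmK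
  -- `w = (u - 1) / m²` lies in the maximal ideal
  set w : K := ((u : K) - 1) / ((m : ℕ) : K) ^ 2 with hw
  have hvw : valuation K w < 1 := by
    rw [hw, map_div₀, div_lt_one₀ ((Valuation.pos_iff _).mpr hm2)]
    exact hu
  have hwint : w ∈ 𝒪[K] := (Valuation.mem_integer_iff _ _).mpr hvw.le
  set wO : 𝒪[K] := ⟨w, hwint⟩ with hwO
  have hwmax : wO ∈ 𝓂[K] := by
    rw [IsLocalRing.mem_maximalIdeal, mem_nonunits_iff,
      (Valuation.integer.integers (valuation K)).isUnit_iff_valuation_eq_one]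
    exact hvw.ne
  -- Hensel
  letI : UniformSpace K := IsTopologicalAddGroup.rightUniformSpace K
  haveI : IsUniformAddGroup K := isUniformAddGroup_of_addCommGroup
  haveI : HenselianLocalRing 𝒪[K] := henselianLocalRing_integer K
  obtain ⟨a, ha, -⟩ := exists_units_pow_eq_one_add m hwmax
  -- `b := a` viewed in `Kˣ`, with `b ^ m = u`
  let b : Kˣ := Units.map ((𝒪[K]).subtype : 𝒪[K] →* K) a
  have hb : b ^ m = u := by
    ext
    have h1 : ((b ^ m : Kˣ) : K) = (((a : 𝒪[K]) ^ m : 𝒪[K]) : K) := by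
      rw [Units.val_pow_eq_pow_val, Units.coe_map, SubmonoidClass.coe_pow]; rfl
    rw [h1, ha]
    have h2 : ((wO : 𝒪[K]) : K) = w := rfl
    push_cast
    rw [h2, hw]
    field_simp
    ring
  rw [← hb]
  exact N.pow_index_mem b

variable {K}

/-- **Unit criterion.** For a reciprocity map `θ` and a subgroup `N ≤ Kˣ` of finite index there
is an open subgroup `V₀ ≤ G_K^{ab}` such that a unit `u ∈ U_K` with `θ u ∈ V₀` lies in `N`:
`θ|_{U_K}` is an embedding (`IsLocalReciprocityMap.isEmbedding_unitGroup`), the units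
`≡ 1 (mod m²𝔪)` form a neighbourhood of `1` in `U_K` contained in `N`
(`mem_of_valuation_sub_one_lt`), and open subgroups form a neighbourhood basis of `1` in the
profinite group `G_K^{ab}`. [cite: MochizukiAbsAnab2004, §1.2 p.9] -/
theorem exists_isOpen_units_criterion {θ : Kˣ →* absoluteGaloisGroupAbelianization K}
    (hθ : IsLocalReciprocityMap K θ) (N : Subgroup Kˣ) [N.FiniteIndex] :
    ∃ V₀ : Subgroup (absoluteGaloisGroupAbelianization K),
      IsOpen (V₀ : Set (absoluteGaloisGroupAbelianization K)) ∧
      ∀ u ∈ (valuation K).valuationSubring.unitGroup, θ u ∈ V₀ → u ∈ N := by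
  haveI := totallyDisconnectedSpace_absoluteGaloisGroupAbelianization K
  set U := (valuation K).valuationSubring.unitGroup with hU
  set m : ℕ := N.index with hmdef
  have hm : m ≠ 0 := Subgroup.FiniteIndex.index_ne_zero
  have hm2 : ((m : ℕ) : K) ^ 2 ≠ 0 := pow_ne_zero _ (Nat.cast_ne_zero.mpr hm)
  let γ : (ValueGroupWithZero K)ˣ :=
    Units.mk0 (valuation K (((m : ℕ) : K) ^ 2)) ((Valuation.ne_zero_iff _).mpr hm2)
  -- the neighbourhood `S` of `1` in `U_K`
  let S : Set U := {u | valuation K (((u : Kˣ) : K) - 1) < γ}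
  have hS : S ∈ 𝓝 (1 : U) := by
    have hc : Continuous fun u : U => ((u : Kˣ) : K) :=
      Units.continuous_val.comp continuous_subtype_val
    have h1 : {z : K | valuation K (z - 1) < γ} ∈ 𝓝 ((((1 : U) : Kˣ) : K)) := by
      rw [show ((((1 : U) : Kˣ) : K)) = 1 from rfl]
      exact IsValuativeTopology.mem_nhds_iff'.mpr ⟨γ, subset_rfl⟩
    exact hc.continuousAt.preimage_mem_nhds h1
  -- transported along the embedding `θ|_{U_K}`
  rw [hθ.isEmbedding_unitGroup.isInducing.nhds_eq_comap (1 : U)] at hS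
  obtain ⟨T, hT, hTS⟩ := Filter.mem_comap.mp hS
  have hT1 : T ∈ 𝓝 (1 : absoluteGaloisGroupAbelianization K) := by
    have : θ (((1 : U) : Kˣ)) = 1 := by rw [OneMemClass.coe_one, map_one]
    rwa [this] at hT
  obtain ⟨H, hH⟩ := ProfiniteGrp.exist_openNormalSubgroup_sub_open_nhds_of_one
    isOpen_interior (mem_interior_iff_mem_nhds.mpr hT1)
  refine ⟨H.toSubgroup, H.isOpen', fun u hu hθu => ?_⟩
  have hmemS : (⟨u, hu⟩ : U) ∈ S :=
    hTS (show θ (((⟨u, hu⟩ : U) : Kˣ)) ∈ T from interior_subset (hH hθu))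
  exact mem_of_valuation_sub_one_lt K N u hmemS

omit [CharZero K] in
/-- Powers of a Frobenius lift are Frobenius powers of the corresponding exponent
(`IsFrobPow.mul_holds`). [cite: MochizukiAbsAnab2004, §1.2 p.9] -/
theorem isFrobPow_pow {σ : absoluteGaloisGroup K} (hσ : IsFrobPow σ 1) (n : ℕ) :
    IsFrobPow (σ ^ n) (n : ℤ) := by
  induction n with
  | zero => rw [pow_zero, Nat.cast_zero]; exact IsFrobPow.one
  | succ n ih =>
    rw [pow_succ, Nat.cast_succ]
    exact IsFrobPow.mul_holds ih hσ

omit [CharZero K] in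
open LocalWeilDatum in
/-- **Frobenius criterion.** For a reciprocity map `θ`, a uniformiser `ϖ` and `m' ≥ 1` there is
an open subgroup `V₁ ≤ G_K^{ab}` containing `θ(U_K)` such that `θ(ϖ)^k ∈ V₁ ⇒ m' ∣ k`: take the
image of the stabiliser of a primitive `(q^{m'} - 1)`-th root of unity `ζ` (the unramified level
`K(ζ)` of degree `m'`, an abelian extension, so the stabiliser contains `closure [G_K, G_K]`);
`θ(ϖ)` is the class of an arithmetic Frobenius `φ`, and `φ^k ζ = ζ ↔ m' ∣ k`
(tree `smul_eq_self_iff_dvd_of_isFrobPow`), while inertia — hence `θ(U_K)` — fixes `ζ`.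
[cite: MochizukiAbsAnab2004, §1.2 p.9] -/
theorem exists_isOpen_frobenius_criterion {θ : Kˣ →* absoluteGaloisGroupAbelianization K}
    (hθ : IsLocalReciprocityMap K θ) {ϖ : Kˣ} (hϖ : (valuation K).IsUniformizer (ϖ : K))
    {m' : ℕ} (hm' : 0 < m') :
    ∃ V₁ : Subgroup (absoluteGaloisGroupAbelianization K),
      IsOpen (V₁ : Set (absoluteGaloisGroupAbelianization K)) ∧
      (∀ u ∈ (valuation K).valuationSubring.unitGroup, θ u ∈ V₁) ∧
      ∀ k : ℤ, θ ϖ ^ k ∈ V₁ → (m' : ℤ) ∣ k := by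
  classical
  -- a Frobenius `σ₀` in the class `θ ϖ`
  obtain ⟨σ₀, hσ₀⟩ := QuotientGroup.mk_surjective (θ ϖ)
  have hfrob : IsFrobPow σ₀ 1 := hθ.isFrobPow_one_of_isUniformizer ϖ hϖ σ₀ hσ₀
  -- the unramified level of degree `m'` and its root of unity `ζ`
  set ζ := rootOfUnramifiedLevel K m' with hζdef
  have hζ := isPrimitiveRoot_rootOfUnramifiedLevel K hm'
  obtain ⟨hfd, hab, hinert⟩ := unramifiedLevel_finite_abelian_unramified K hm'
  haveI := hfd
  haveI := hab
  set E := unramifiedLevel K m' with hE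
  have hζE : ζ ∈ E := IntermediateField.mem_adjoin_simple_self K ζ
  -- the stabiliser of `ζ`
  set H₁ : Subgroup (absoluteGaloisGroup K) := MulAction.stabilizer (absoluteGaloisGroup K) ζ
    with hH₁
  have hfix_le : E.fixingSubgroup ≤ H₁ := fun σ hσ => by
    change (absoluteGaloisGroup.toAlgEquiv K σ) ζ = ζ
    exact (IntermediateField.mem_fixingSubgroup_iff E σ).mp hσ ζ hζE
  have hH₁open : IsOpen (H₁ : Set (absoluteGaloisGroup K)) :=
    Subgroup.isOpen_mono hfix_le E.fixingSubgroup_isOpen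
  -- restriction to the abelian extension `E`: the commutator subgroup fixes `ζ`
  let ρ : absoluteGaloisGroup K →* (E ≃ₐ[K] E) :=
    (AlgEquiv.restrictNormalHom E).comp (absoluteGaloisGroup.toAlgEquiv K).toMonoidHom
  have hρker : ρ.ker ≤ H₁ := fun σ hσ => by
    rw [MonoidHom.mem_ker] at hσ
    change (absoluteGaloisGroup.toAlgEquiv K σ) ζ = ζ
    have h1 := AlgEquiv.restrictNormal_commutes (absoluteGaloisGroup.toAlgEquiv K σ) E ⟨ζ, hζE⟩
    have h2 : (absoluteGaloisGroup.toAlgEquiv K σ).restrictNormal E = 1 := hσ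
    rw [h2, AlgEquiv.one_apply] at h1
    exact h1.symm
  have hcomm : (commutator (absoluteGaloisGroup K)).topologicalClosure ≤ H₁ := by
    refine Subgroup.topologicalClosure_minimal _ ?_ (Subgroup.isClosed_of_isOpen _ hH₁open)
    refine le_trans ?_ hρker
    rw [commutator, Subgroup.commutator_le]
    intro σ _ τ _
    rw [MonoidHom.mem_ker, map_commutatorElement, commutatorElement_def,
      IsMulCommutative.is_comm.comm (ρ σ), mul_inv_cancel_right, mul_inv_cancel]
  set V₁ : Subgroup (absoluteGaloisGroupAbelianization K) := H₁.map (absGaloisAbProj K) with hV₁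
  -- membership in `V₁` is detected on `G_K`
  have hmemV₁ : ∀ τ : absoluteGaloisGroup K, absGaloisAbProj K τ ∈ V₁ ↔ τ ∈ H₁ := by
    intro τ
    constructor
    · rintro ⟨σ, hσ, hστ⟩
      have h1 : σ⁻¹ * τ ∈ (commutator (absoluteGaloisGroup K)).topologicalClosure := by
        rw [← QuotientGroup.eq]; exact hστ
      have h2 := hcomm h1
      simpa using H₁.mul_mem hσ h2
    · intro hτ; exact ⟨τ, hτ, rfl⟩
  refine ⟨V₁, ?_, ?_, ?_⟩
  · rw [hV₁, Subgroup.coe_map]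
    exact QuotientGroup.isOpenMap_coe _ hH₁open
  · -- `θ(U_K) = image of inertia ≤ V₁`
    intro u hu
    have hmem : θ u ∈ (absInertia K).map (absGaloisAbProj K) := by
      rw [← hθ.map_unitGroup]; exact ⟨u, hu, rfl⟩
    obtain ⟨σ, hσI, hσu⟩ := hmem
    rw [← hσu, hmemV₁, hH₁, MulAction.mem_stabilizer_iff]
    exact hinert σ hσI ⟨ζ, hζE⟩
  · intro k hk
    have h0 : absGaloisAbProj K (σ₀ ^ k) = θ ϖ ^ k := by
      rw [map_zpow]; exact congrArg (· ^ k) hσ₀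
    have hk' : σ₀ ^ k ∈ H₁ := (hmemV₁ (σ₀ ^ k)).mp (h0 ▸ hk)
    change (σ₀ ^ k) • ζ = ζ at hk'
    -- `σ₀ ^ k • ζ = ζ ⇒ m' ∣ k`
    rcases Int.eq_nat_or_neg k with ⟨n, rfl | rfl⟩
    · rw [zpow_natCast] at hk'
      exact Int.natCast_dvd_natCast.mpr
        ((smul_eq_self_iff_dvd_of_isFrobPow K hm' hζ (isFrobPow_pow hfrob n)).mp hk')
    · rw [zpow_neg, zpow_natCast, inv_smul_eq_iff] at hk'
      exact (dvd_neg).mpr (Int.natCast_dvd_natCast.mpr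
        ((smul_eq_self_iff_dvd_of_isFrobPow K hm' hζ (isFrobPow_pow hfrob n)).mp hk'.symm))

/-- **Cofinality.** For a reciprocity map `θ` and a subgroup `N ≤ Kˣ` of finite index `m`
there is an open subgroup `V ≤ G_K^{ab}` with `θ⁻¹(V) ≤ N`: `V = V₀ ∩ V₁` with `V₀` from the
unit criterion and `V₁` from the Frobenius criterion at level `m · [G_K^{ab} : V₀]`; for
`x = u ϖ^k` with `θ x ∈ V`, `m [G^{ab} : V₀] ∣ k` forces `ϖ^k ∈ N`, `θ(ϖ)^k ∈ V₀`, hence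
`θ u ∈ V₀` and `u ∈ N`.  (This is the statement "every subgroup of finite index of `K^×` is a
norm group", Serre *Local Fields* XIV §6 Thm. 1 with Cor. 1, in the form needed for the
completion.) [cite: MochizukiAbsAnab2004, §1.2 p.9] -/
theorem exists_isOpen_comap_le {θ : Kˣ →* absoluteGaloisGroupAbelianization K}
    (hθ : IsLocalReciprocityMap K θ) (N : Subgroup Kˣ) [N.FiniteIndex] :
    ∃ V : Subgroup (absoluteGaloisGroupAbelianization K),
      IsOpen (V : Set (absoluteGaloisGroupAbelianization K)) ∧ V.comap θ ≤ N := by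
  haveI := totallyDisconnectedSpace_absoluteGaloisGroupAbelianization K
  obtain ⟨V₀, hV₀open, hV₀⟩ := exists_isOpen_units_criterion hθ N
  haveI : Finite (absoluteGaloisGroupAbelianization K ⧸ V₀) :=
    Subgroup.quotient_finite_of_isOpen V₀ hV₀open
  haveI : V₀.FiniteIndex := Subgroup.finiteIndex_of_finite_quotient
  set r : ℕ := V₀.index with hrdef
  have hr : r ≠ 0 := Subgroup.FiniteIndex.index_ne_zero
  set m : ℕ := N.index with hmdef
  have hm : m ≠ 0 := Subgroup.FiniteIndex.index_ne_zero
  obtain ⟨ϖ, hϖ⟩ := exists_isUniformizer K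
  obtain ⟨V₁, hV₁open, hV₁U, hV₁ϖ⟩ :=
    exists_isOpen_frobenius_criterion hθ hϖ (m' := m * r) (Nat.pos_of_ne_zero (mul_ne_zero hm hr))
  refine ⟨V₀ ⊓ V₁, hV₀open.inter hV₁open, fun x hx => ?_⟩
  rw [Subgroup.mem_comap, Subgroup.mem_inf] at hx
  obtain ⟨hx0, hx1⟩ := hx
  obtain ⟨u, k, hu, rfl⟩ := exists_unitGroup_mul_zpow hϖ x
  rw [map_mul, map_zpow] at hx0 hx1
  have hk : θ ϖ ^ k ∈ V₁ := by
    have := V₁.mul_mem (V₁.inv_mem (hV₁U u hu)) hx1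
    rwa [inv_mul_cancel_left] at this
  obtain ⟨j, hj⟩ := hV₁ϖ k hk
  have hϖk : ϖ ^ k ∈ N := by
    rw [hj, show ((m * r : ℕ) : ℤ) * j = (r * j) * (m : ℕ) by push_cast; ring, zpow_mul,
      zpow_natCast]
    exact N.pow_index_mem _
  have hθϖk : θ ϖ ^ k ∈ V₀ := by
    rw [hj, show ((m * r : ℕ) : ℤ) * j = (m * j) * (r : ℕ) by push_cast; ring, zpow_mul,
      zpow_natCast]
    exact V₀.pow_index_mem _
  have hθu : θ u ∈ V₀ := by
    have := V₀.mul_mem hx0 (V₀.inv_mem hθϖk)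
    rwa [mul_inv_cancel_right] at this
  exact N.mul_mem (hV₀ u hu hθu) hϖk

end Local

end Literature.AnabelianGeometry.AbsoluteAnabelian
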